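import Literature.NumberTheory.ComplexMultiplication.CasselmanFiniteLevelReciprocity
import HarnessLib

/-!
# `stub_finiteLevelReciprocity` of line `a2b-twisted-galois-model` (binder `h21` → `Hyp21`, Shimura 1998 Thm. 21.4)

Cell `hodgecm-mathlib` (D-0151 release track, ladder HODGECM-MATHLIB rung 0), fan A, rung A-II, KEY
`a2-twisted-galois-model`, item `stmt-HodgeConjecture-24834` (Hyp21).  The line `a2b-twisted-galois-model`
(crux workfile `A-plan/lines/a2b-twisted-galois-model.lean`, v3 67ff8cf68c28b4ab = … = v6 9f1376eceb8d6df3 for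
this stub, namespace `Summit.HodgeConjecture.CorCM.Cruxes.Hyp21.TwistedGaloisModel`) splits Shimura's proof of
Thm. 21.4 (Casselman; [Shimura1998] p. 192) into the `λ`-family (STUB 1), the lift-independence of the
multiplier (I), **finite-level reciprocity (FL)**, the twisted model (TM), reciprocity of the descent (RD)
and Weil descent.  FL = Shimura p. 192 L12–14: «we can find a finite Galois extension `k₂` of `k` containing
`k₁` such that … `r(w)^σ = r(c_σ w)` for all `σ ∈ Gal(ℂ/k₂)`» (via Prop. 21.1).

This file closes FL with its EXACT registered signature by the Literature theorem
`Literature.NumberTheory.ComplexMultiplication.finiteLevelReciprocity`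
(`CasselmanFiniteLevelReciprocity`: the finite-level factorisation engine `FiniteLevelFactorisation` over
`Gal(k̄₁/k₁(θ))`, the continuity of Shimura's twist character `CasselmanTwistCharacterFiniteLevel`, the
multiplier and torsion avatars `CasselmanFiniteLevelMultiplier`, the finite level `AutComplexFiniteLevel`).
Of the binder hypotheses only `hK` (`K* ⊆ k`) and the first conjunct of (19.10b) (`hb`) are used, besides
`hlam` and `hindep`.  No named fact is used; the statement is unconditional.  HC_CM itself is proved only
modulo the 7 printed citations until rung 0 closes — this file discharges one stub of the `h21` line.
-/

set_option autoImplicit false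

noncomputable section

open CategoryTheory IsDedekindDomain NumberField
open scoped NumberField ComplexConjugate nonZeroDivisors

namespace Summit.HodgeConjecture.CorCM.Cruxes.Hyp21.TwistedGaloisModel

open Literature.AlgebraicGeometry.Motives
open Literature.NumberTheory.GaloisRepresentations
open Literature.NumberTheory.ComplexMultiplication
open Literature.NumberTheory.NumberFields.IdeleAction (ideleMulIdeal ideleMulEquiv)
open Literature.NumberTheory.AdelicBaseChange (ideleRelNorm)
open Literature.AlgebraicGeometry.ComplexMultiplication (IsCMTypeRealisation)

/-- **`stub_finiteLevelReciprocity` holds (finite-level reciprocity; Shimura 1998, proof of Thm. 21.4,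
p. 192 L12–14 with Prop. 21.1).**  Under the hypotheses of Thm. 21.4 (binder `h21` verbatim), for a structure
`(A₁, ι₁)` of type `(K, Φ)` over a number field `k₁ ⊂ ℂ` uniformised by `ξ`, given the `λ`-family (`hlam`,
STUB 1) and the lift-independence of `t = b·f(y)⁻¹` (`hindep`, stub I): there is a finite Galois extension
`k₂ ⊇ k k₁` of `k` (a number field, with the tower instances) such that every `σ₁ ∈ Aut(ℂ/k₁)` agreeing with a
`σ ∈ Aut(ℂ/k)` that fixes `k₂` satisfies `σ₁ · x_u = x_v` whenever `t u ≡ v (mod 𝔞)`.  The statement is the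
registered stub's, verbatim; the proof is `Literature.NumberTheory.ComplexMultiplication.finiteLevelReciprocity`.
[cite: Shimura1998, §21.4 proof of Thm. 21.4 p. 192 L8–14; §21.1 Prop. 21.1 pp. 189–191] -/
theorem stub_finiteLevelReciprocity_holds :
    ∀ (k : Type) [Field k] [NumberField k] [Algebra k ℂ] (K : Type) [Field K] [NumberField K]
      [IsCMField K] (Φ : CMType K) (τ₀ : K →+* ℂ) (χ : HeckeCharacter k),
    ((traceField Φ : Set ℂ) ⊆ Set.range (algebraMap k ℂ)) →
    χ.HasInfinityType (cmInfinityType Φ.1 τ₀ (algebraMap k ℂ)).1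
      (cmInfinityType Φ.1 τ₀ (algebraMap k ℂ)).2 →
    (∀ x : ideleGroup k, (x : AdeleRing (𝓞 k) k).1 = 1 →
      (∃ b : K, ((χ x : ℂˣ) : ℂ) = τ₀ b) ∧
        ((χ x : ℂˣ) : ℂ) * conj ((χ x : ℂˣ) : ℂ) = (((ideleNorm x)⁻¹ : ℝ) : ℂ)) →
    (∀ (v : HeightOneSpectrum (𝓞 k)) (u : (v.adicCompletionIntegers k)ˣ),
      ∃ b : (𝓞 K)ˣ, ((χ.localComponent v
        (Units.map ((v.adicCompletionIntegers k).subtype : _ →* _) u) : ℂˣ) : ℂ) =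
        τ₀ ((b : 𝓞 K) : K)) →
    (∀ v : HeightOneSpectrum (𝓞 k), ∃ π : 𝓞 K, χ.valueAtUniformizer v = τ₀ (π : K) ∧
      ∀ (L : Type) [Field L] [NumberField L] [Normal ℚ L] (ιL : L →+* ℂ) (j : K →+* L)
        (σL : k →+* L), ιL.comp σL = algebraMap k ℂ →
        IsReflexTypeNorm (valuedIn ιL Φ.1) j σL v.asIdeal (Ideal.span {π})) →
    ∀ (k₁ : Type) [Field k₁] [NumberField k₁] [Algebra k₁ ℂ] (A₁ : AbelianVariety k₁)
      (ι₁ : 𝓞 K →+* End A₁), IsCMTypeRealisationOver Φ A₁ ι₁ →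
    ∀ (𝔞 : (FractionalIdeal (𝓞 K)⁰ K)ˣ)
      (ξ : CMTypeUniformization Φ 𝔞 (A₁.baseChange ℂ) ((A₁.endBaseChange ℂ).comp ι₁)),
    (∀ [NumberField ↥(traceField Φ)] [Algebra ↥(traceField Φ) k] [IsScalarTower ↥(traceField Φ) k ℂ]
        (σ : ℂ ≃ₐ[k] ℂ) (y : ideleGroup k), IsArtinLift k y σ →
        ∀ b : Kˣ, ((χ ((infiniteIdeles k (HeckeCharacter.infPart k y))⁻¹ * y) : ℂˣ) : ℂ) = τ₀ (b : K) →
        ∃ lam : A₁.baseChange ℂ ≅ (A₁.baseChange ℂ).conjugate σ.toRingEquiv,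
          (∀ a : 𝓞 K, ((A₁.endBaseChange ℂ).comp ι₁ a : _ ⟶ _) ≫ lam.hom =
            lam.hom ≫ (((A₁.baseChange ℂ).endConjugate σ.toRingEquiv) ((A₁.endBaseChange ℂ).comp ι₁ a) : _ ⟶ _)) ∧
          ∀ u v : K,
            ideleMulEquiv (FiniteAdeleRing.unitEmbedding (𝓞 K) K b * (reflexNormFinitePart K Φ (traceField Φ) (ideleRelNorm (↥(traceField Φ)) k y))⁻¹)
              (𝔞 : FractionalIdeal (𝓞 K)⁰ K) 𝔞.ne_zero (Submodule.Quotient.mk u) = Submodule.Quotient.mk v →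
            (A₁.baseChange ℂ).conjPoints σ.toRingEquiv (ξ.r u) = AlgPoints.map lam.hom.hom.hom.hom (ξ.r v)) →
    (∀ [NumberField ↥(traceField Φ)] [Algebra ↥(traceField Φ) k] [IsScalarTower ↥(traceField Φ) k ℂ]
        (σ : ℂ ≃ₐ[k] ℂ) (y y' : ideleGroup k), IsArtinLift k y σ → IsArtinLift k y' σ →
        ∀ b b' : Kˣ, ((χ ((infiniteIdeles k (HeckeCharacter.infPart k y))⁻¹ * y) : ℂˣ) : ℂ) = τ₀ (b : K) →
          ((χ ((infiniteIdeles k (HeckeCharacter.infPart k y'))⁻¹ * y') : ℂˣ) : ℂ) = τ₀ (b' : K) →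
          FiniteAdeleRing.unitEmbedding (𝓞 K) K b *
              (reflexNormFinitePart K Φ (traceField Φ) (ideleRelNorm (↥(traceField Φ)) k y))⁻¹ =
            FiniteAdeleRing.unitEmbedding (𝓞 K) K b' *
              (reflexNormFinitePart K Φ (traceField Φ) (ideleRelNorm (↥(traceField Φ)) k y'))⁻¹) →
    ∃ (k₂ : Type) (_ : Field k₂) (_ : NumberField k₂) (_ : Algebra k k₂) (_ : Algebra k₂ ℂ)
      (_ : IsScalarTower k k₂ ℂ) (_ : FiniteDimensional k k₂) (_ : IsGalois k k₂)
      (_ : Algebra k₁ k₂) (_ : IsScalarTower k₁ k₂ ℂ),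
      ∀ [NumberField ↥(traceField Φ)] [Algebra ↥(traceField Φ) k] [IsScalarTower ↥(traceField Φ) k ℂ]
        (σ : ℂ ≃ₐ[k] ℂ) (σ₁ : ℂ ≃ₐ[k₁] ℂ), (∀ z : ℂ, σ₁ z = σ z) →
        (∀ x : k₂, σ (algebraMap k₂ ℂ x) = algebraMap k₂ ℂ x) →
        ∀ (y : ideleGroup k), IsArtinLift k y σ →
        ∀ b : Kˣ, ((χ ((infiniteIdeles k (HeckeCharacter.infPart k y))⁻¹ * y) : ℂˣ) : ℂ) = τ₀ (b : K) →
          ∀ u v : K,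
            ideleMulEquiv (FiniteAdeleRing.unitEmbedding (𝓞 K) K b * (reflexNormFinitePart K Φ (traceField Φ) (ideleRelNorm (↥(traceField Φ)) k y))⁻¹)
                    (𝔞 : FractionalIdeal (𝓞 K)⁰ K) 𝔞.ne_zero (Submodule.Quotient.mk u) = Submodule.Quotient.mk v →
            σ₁ • (A₁.pointsMulEquiv ℂ).symm (ξ.r u) = (A₁.pointsMulEquiv ℂ).symm (ξ.r v) := by
  intro k _ _ _ K _ _ _ Φ τ₀ χ hK _ hb _ _ k₁ _ _ _ A₁ ι₁ hA₁ 𝔞 ξ hlam hindep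
  exact finiteLevelReciprocity Φ τ₀ χ hK (fun x hx => (hb x hx).1) A₁ ι₁ hA₁ 𝔞 ξ hlam hindep

end Summit.HodgeConjecture.CorCM.Cruxes.Hyp21.TwistedGaloisModel

end
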